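import Mathlib.Algebra.BigOperators.Intervals
import Mathlib.Tactic
import Summits.CriticalPhenomena.PercolationContinuityZ3.Theorems.PercNearOneGluingNoHeavyLowerTailChainTP2
import HarnessLib

/-!
# Toeplitz kernels of log-concave sequences are TP₂ along the chain; the three-rate array is TP₂

Support file for the Sahi / Conjecture-P programme of route `PercNearOneGluingNoHeavy`
(`--supports stmt-CriticalPhenomena-4575`, prover prim-l12-p5 gen 25; proof note
`prim-l12-p5/OMEGA-g25.md` §1, Lemma 1.2 and Theorem 3R).  No definitions, no named facts, no sorries.

Setting (note §1): for a THREE-RATE law (tokens `O₁, O₂, Y`) the two-block partition function satisfies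
`Zc(a,c)/(a! c!) = ∑_r h_r · A(a,r) · B(c,r)` with `h_r = Θ^{(r)}/r! ≥ 0` and kernels of the shape
`A(a,r) = u(a) · v(r) · φ(a - r)` (`r ≤ a`, else `0`) where `u, v > 0` and `φ(n) = 1/n!` is positive and
log-concave.  `shifted_lc` is the standard consequence `φ(i+d₁+d₂) φ(i) ≤ φ(i+d₁) φ(i+d₂)` of
log-concavity, `toeplitz_tp2` the resulting TP₂ comparison of the kernel along the chain index (the
hypothesis `hA` of `ChainTP2.tp2_of_chain`), and `three_rate_shape_tp2` assembles the two: every array of this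
shape is TP₂ — the analytic content of Theorem 3R (LSM-Z-2D for three-rate laws).
-/

namespace Summit.CriticalPhenomena.PercolationContinuityZ3.Theorems

namespace ToeplitzTP2

open Finset

variable {φ : ℕ → ℝ}

/-- One step: log-concavity propagates to `φ (i+1+d) φ i ≤ φ (i+1) φ (i+d)`. -/
theorem lc_one (hpos : ∀ n, 0 < φ n) (hlc : ∀ n, φ (n + 2) * φ n ≤ φ (n + 1) * φ (n + 1))
    (i d : ℕ) : φ (i + 1 + d) * φ i ≤ φ (i + 1) * φ (i + d) := by
  induction d with
  | zero => simp
  | succ d ih =>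
    -- multiply the induction hypothesis by φ(i+d+2) and use log-concavity at i+d
    have h1 : φ (i + 1 + d) * φ i * φ (i + d + 2) ≤ φ (i + 1) * φ (i + d) * φ (i + d + 2) :=
      mul_le_mul_of_nonneg_right ih (le_of_lt (hpos _))
    have h2 : φ (i + d + 2) * φ (i + d) ≤ φ (i + d + 1) * φ (i + d + 1) := hlc (i + d)
    have h3 : φ (i + 1) * φ (i + d) * φ (i + d + 2) ≤ φ (i + 1) * (φ (i + d + 1) * φ (i + d + 1)) := by
      have := mul_le_mul_of_nonneg_left h2 (le_of_lt (hpos (i + 1)))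
      calc φ (i + 1) * φ (i + d) * φ (i + d + 2) = φ (i + 1) * (φ (i + d + 2) * φ (i + d)) := by ring
        _ ≤ φ (i + 1) * (φ (i + d + 1) * φ (i + d + 1)) := this
    have h4 : φ (i + 1 + d) * φ i * φ (i + d + 2) ≤ φ (i + 1) * (φ (i + d + 1) * φ (i + d + 1)) :=
      le_trans h1 h3
    have hq : 0 < φ (i + d + 1) := hpos _
    -- φ(i+1+d) = φ(i+d+1); cancel one factor φ(i+d+1)
    have e1 : φ (i + 1 + d) = φ (i + d + 1) := by ring_nf
    rw [e1] at h4
    have h5 : φ (i + d + 1) * (φ i * φ (i + d + 2)) ≤ φ (i + d + 1) * (φ (i + 1) * φ (i + d + 1)) := by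
      calc φ (i + d + 1) * (φ i * φ (i + d + 2)) = φ (i + d + 1) * φ i * φ (i + d + 2) := by ring
        _ ≤ φ (i + 1) * (φ (i + d + 1) * φ (i + d + 1)) := h4
        _ = φ (i + d + 1) * (φ (i + 1) * φ (i + d + 1)) := by ring
    have h6 : φ i * φ (i + d + 2) ≤ φ (i + 1) * φ (i + d + 1) := le_of_mul_le_mul_left h5 hq
    have e2 : i + 1 + (d + 1) = i + d + 2 := by ring
    have e3 : i + (d + 1) = i + d + 1 := by ring
    rw [e2, e3]
    calc φ (i + d + 2) * φ i = φ i * φ (i + d + 2) := by ring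
      _ ≤ φ (i + 1) * φ (i + d + 1) := h6

/-- **Shifted log-concavity.** `φ (i+d₁+d₂) φ i ≤ φ (i+d₁) φ (i+d₂)` for a positive log-concave `φ`. -/
theorem shifted_lc (hpos : ∀ n, 0 < φ n) (hlc : ∀ n, φ (n + 2) * φ n ≤ φ (n + 1) * φ (n + 1))
    (i d₁ d₂ : ℕ) : φ (i + d₁ + d₂) * φ i ≤ φ (i + d₁) * φ (i + d₂) := by
  induction d₁ generalizing i with
  | zero => simp [mul_comm]
  | succ d₁ ih =>
    -- P(d₁) at i and P(1) at i+d₁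
    have hP1 : φ (i + d₁ + 1 + d₂) * φ (i + d₁) ≤ φ (i + d₁ + 1) * φ (i + d₁ + d₂) :=
      lc_one hpos hlc (i + d₁) d₂
    have hPd : φ (i + d₁ + d₂) * φ i ≤ φ (i + d₁) * φ (i + d₂) := ih i
    have hprod : (φ (i + d₁ + 1 + d₂) * φ (i + d₁)) * (φ (i + d₁ + d₂) * φ i) ≤
        (φ (i + d₁ + 1) * φ (i + d₁ + d₂)) * (φ (i + d₁) * φ (i + d₂)) :=
      mul_le_mul hP1 hPd (mul_nonneg (le_of_lt (hpos _)) (le_of_lt (hpos _)))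
        (mul_nonneg (le_of_lt (hpos _)) (le_of_lt (hpos _)))
    have hc : 0 < φ (i + d₁) * φ (i + d₁ + d₂) := mul_pos (hpos _) (hpos _)
    have h7 : (φ (i + d₁) * φ (i + d₁ + d₂)) * (φ (i + d₁ + 1 + d₂) * φ i) ≤
        (φ (i + d₁) * φ (i + d₁ + d₂)) * (φ (i + d₁ + 1) * φ (i + d₂)) := by
      calc (φ (i + d₁) * φ (i + d₁ + d₂)) * (φ (i + d₁ + 1 + d₂) * φ i)
          = (φ (i + d₁ + 1 + d₂) * φ (i + d₁)) * (φ (i + d₁ + d₂) * φ i) := by ring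
        _ ≤ (φ (i + d₁ + 1) * φ (i + d₁ + d₂)) * (φ (i + d₁) * φ (i + d₂)) := hprod
        _ = (φ (i + d₁) * φ (i + d₁ + d₂)) * (φ (i + d₁ + 1) * φ (i + d₂)) := by ring
    have h8 := le_of_mul_le_mul_left h7 hc
    have e1 : i + (d₁ + 1) + d₂ = i + d₁ + 1 + d₂ := by ring
    have e2 : i + (d₁ + 1) = i + d₁ + 1 := by ring
    rw [e1, e2]
    exact h8

variable (u v : ℕ → ℝ)

/-- **Toeplitz kernels of log-concave sequences are TP₂ along the chain** (Lemma 1.2 of the note): for the kernel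
`A a r = u a · v r · φ (a - r)` (`r ≤ a`) and `= 0` (`r > a`), with `u, v > 0` and `φ` positive log-concave,
and rows `a ≤ a'`: `A a' r · A a r' ≤ A a r · A a' r'` whenever `r ≤ r'`. -/
theorem toeplitz_tp2 (A : ℕ → ℕ → ℝ) (hpos : ∀ n, 0 < φ n)
    (hlc : ∀ n, φ (n + 2) * φ n ≤ φ (n + 1) * φ (n + 1))
    (hu : ∀ a, 0 < u a) (hv : ∀ r, 0 < v r)
    (hform : ∀ a r, r ≤ a → A a r = u a * v r * φ (a - r))
    (hzero : ∀ a r, a < r → A a r = 0)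
    {a a' : ℕ} (haa : a ≤ a') :
    ∀ r r', r ≤ r' → A a' r * A a r' ≤ A a r * A a' r' := by
  intro r r' hrr
  have hAnn : ∀ b s, 0 ≤ A b s := by
    intro b s
    rcases Nat.lt_or_ge b s with h | h
    · rw [hzero b s h]
    · rw [hform b s h]
      exact le_of_lt (mul_pos (mul_pos (hu b) (hv s)) (hpos _))
  rcases Nat.lt_or_ge a r' with hlt | hge
  · -- A a r' = 0
    rw [hzero a r' hlt, mul_zero]
    exact mul_nonneg (hAnn _ _) (hAnn _ _)
  · -- r ≤ r' ≤ a ≤ a' : write r' = r + d₁, a = r' + i, a' = a + d₂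
    obtain ⟨d₁, hd₁⟩ := Nat.exists_eq_add_of_le hrr
    obtain ⟨i, hi⟩ := Nat.exists_eq_add_of_le hge
    obtain ⟨d₂, hd₂⟩ := Nat.exists_eq_add_of_le haa
    have har : r ≤ a := le_trans hrr hge
    have ha'r : r ≤ a' := le_trans har haa
    have ha'r' : r' ≤ a' := le_trans hge haa
    rw [hform a' r ha'r, hform a r' hge, hform a r har, hform a' r' ha'r']
    have s1 : a' - r = i + d₁ + d₂ := by omega
    have s2 : a - r' = i := by omega
    have s3 : a - r = i + d₁ := by omega
    have s4 : a' - r' = i + d₂ := by omega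
    rw [s1, s2, s3, s4]
    have key := shifted_lc hpos hlc i d₁ d₂
    have hc : 0 < u a' * v r * (u a * v r') := mul_pos (mul_pos (hu _) (hv _)) (mul_pos (hu _) (hv _))
    calc u a' * v r * φ (i + d₁ + d₂) * (u a * v r' * φ i)
        = (u a' * v r * (u a * v r')) * (φ (i + d₁ + d₂) * φ i) := by ring
      _ ≤ (u a' * v r * (u a * v r')) * (φ (i + d₁) * φ (i + d₂)) :=
          mul_le_mul_of_nonneg_left key (le_of_lt hc)
      _ = u a * v r * φ (i + d₁) * (u a' * v r' * φ (i + d₂)) := by ring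

/-- **Theorem 3R, analytic form.**  If `h ≥ 0` and `A`, `B` are Toeplitz-type kernels of positive log-concave
sequences as in `toeplitz_tp2`, then `f a c = ∑_{r<N} h r · A a r · B c r` is TP₂:
`f a' c · f a c' ≤ f a c · f a' c'` for `a ≤ a'`, `c ≤ c'`. -/
theorem three_rate_shape_tp2 (h : ℕ → ℝ) (A B : ℕ → ℕ → ℝ) (φ ψ uA vA uB vB : ℕ → ℝ)
    (hh : ∀ r, 0 ≤ h r)
    (hφ : ∀ n, 0 < φ n) (hφlc : ∀ n, φ (n + 2) * φ n ≤ φ (n + 1) * φ (n + 1))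
    (hψ : ∀ n, 0 < ψ n) (hψlc : ∀ n, ψ (n + 2) * ψ n ≤ ψ (n + 1) * ψ (n + 1))
    (huA : ∀ a, 0 < uA a) (hvA : ∀ r, 0 < vA r) (huB : ∀ c, 0 < uB c) (hvB : ∀ r, 0 < vB r)
    (hAform : ∀ a r, r ≤ a → A a r = uA a * vA r * φ (a - r)) (hAzero : ∀ a r, a < r → A a r = 0)
    (hBform : ∀ c r, r ≤ c → B c r = uB c * vB r * ψ (c - r)) (hBzero : ∀ c r, c < r → B c r = 0)
    (N : ℕ) {a a' c c' : ℕ} (haa : a ≤ a') (hcc : c ≤ c') :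
    (∑ r ∈ range N, h r * A a' r * B c r) * (∑ r ∈ range N, h r * A a r * B c' r) ≤
      (∑ r ∈ range N, h r * A a r * B c r) * (∑ r ∈ range N, h r * A a' r * B c' r) :=
  ChainTP2.tp2_of_chain h A B N a a' c c' hh
    (toeplitz_tp2 uA vA A hφ hφlc huA hvA hAform hAzero haa)
    (toeplitz_tp2 uB vB B hψ hψlc huB hvB hBform hBzero hcc)

end ToeplitzTP2

end Summit.CriticalPhenomena.PercolationContinuityZ3.Theorems
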